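import Summits.AtomisticToContinuum.Crystallization.Theorems.OverbindingBudgetAffineLadder

/-!
# NODE g79 «CompressedCut», toward the open leaf NS♭₂ — the DIFFERENCE-VECTOR DICTIONARY between adjacent affine frames (first brick of the FRAME half)

Route `OverbindingBudget` (Crystallization), crux `RobustDefectLimitWindows` (stmt-AtomisticToContinuum-31280), decomp-a2c lens 4, generation 79, ADDENDUM 4.
Companion of `…OverbindingBudgetAffineCompressedCutScale` (the SCALE half).  The FRAME half of the NS♭₂ development (memo NODE-g79 §5 (a)) must show that the
affine frames `(Q, A, P, f)` at `j` (scale `s = nn_j`) and `(Q', A', P', f')` at an adjacent site `k = f v_k` (scale `s' = nn_k`) agree modulo a pattern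
symmetry up to `O(θ + ε)`.  Its atomic step, PROVED here over the frame DATA (the components of `AffFramed ε θ g`), potential-free:

* `dict_step` — every pattern point `v ∈ P` of `j`'s frame whose site `f v ≠ y k` lies within the exhaustive radius `(3/2 + g)·s'` of `y k` is a pattern point
  `w ∈ P'` of `k`'s frame, `f' w = f v`, with `‖s'·A' w − s·(A v − A v_k)‖ ≤ 2ε·s + ε·s'` (three registration tolerances, nothing else);
* `dict_base` — the site `j` itself is `f' w₀` with `‖s'·A' w₀ + s·A v_k‖ ≤ ε·s + ε·s'`;
* `frame_diff_le` / `le_frame_diff` — `‖A v − A w‖ ∈ [‖v − w‖ − 2θ, ‖v − w‖ + 2θ]` on pattern points (no operator norm of `A − Q` is ever needed);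
* `dict_reach` — the reach hypothesis of `dict_step` from a pattern distance and a scale comparison `λ₀·s ≤ s'`: `‖v − v_k‖ + 2θ + 2ε ≤ λ₀·(3/2 + g)` suffices;
  at the record literals `(ε, θ, g) = (10⁻⁴, 10⁻³, 1/450)` with the one-step ratio `λ₀ = 9967/10⁴` of the SCALE half, every `v` with `‖v − v_k‖ ≤ 149/100` —
  in particular all pattern points at distance `1` or `√2` from `v_k` — is in the dictionary's domain (`dict_reach_record`).

* `dict_normClass` (+ `_record`) — under the dictionary inequality and the two-sided scale comparison of the SCALE half, `‖v − v_k‖ = 1 ⇒ ‖w‖ = 1` and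
  `‖v − v_k‖ = √2 ⇒ ‖w‖ = √2`: the dictionary never mixes the two shells (gap `√2 − 1 ≈ 0.41` against errors `≈ 0.006`).

What remains of the frame half (g80): the dictionary `v − v_k ↦ w` also preserves the pairwise distance classes of the patterns (same argument, errors
`O(θ + ε)·s` against gaps `≥ 0.2·s`), hence is the restriction of a linear isometry by the rigidity of the two-shell patterns; iterate along first-shell chains
with the SCALE half's coherence.  Deps: tree only (`…OverbindingBudgetAffineLadder`).  No `instance`, no `notation`, no new axioms, 0 sorry.
-/

namespace Summit.AtomisticToContinuum.Crystallization.Theorems.OverbindingBudgetAffineCompressedCutDict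

open Literature.Geometry.DiscreteGeometry (nearestDist nearestDist_nonneg fccTwoShellPattern hcpTwoShellPattern norm_of_mem_fccTwoShellPattern
  norm_of_mem_hcpTwoShellPattern)

variable {N : ℕ}

/-! ## §1  Differences of frame vectors -/

/-- On pattern points an affine frame distorts difference vectors by at most `2θ` upward … [this file] -/
theorem frame_diff_le {θ : ℝ} {A : EuclideanSpace ℝ (Fin 3) →ₗ[ℝ] EuclideanSpace ℝ (Fin 3)}
    {Q : EuclideanSpace ℝ (Fin 3) →ₗᵢ[ℝ] EuclideanSpace ℝ (Fin 3)} {P : Finset (EuclideanSpace ℝ (Fin 3))}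
    (hA : ∀ v ∈ P, ‖A v - Q v‖ ≤ θ) {v w : EuclideanSpace ℝ (Fin 3)} (hv : v ∈ P) (hw : w ∈ P) :
    ‖A v - A w‖ ≤ ‖v - w‖ + 2 * θ := by
  have h1 : ‖Q v - Q w‖ = ‖v - w‖ := by rw [← map_sub, Q.norm_map]
  have h3 : A v - A w = (Q v - Q w) + ((A v - Q v) - (A w - Q w)) := by abel
  rw [h3]
  have h4 := norm_add_le (Q v - Q w) ((A v - Q v) - (A w - Q w))
  have h5 := norm_sub_le (A v - Q v) (A w - Q w)
  linarith [hA v hv, hA w hw]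

/-- … and by at most `2θ` downward. [this file] -/
theorem le_frame_diff {θ : ℝ} {A : EuclideanSpace ℝ (Fin 3) →ₗ[ℝ] EuclideanSpace ℝ (Fin 3)}
    {Q : EuclideanSpace ℝ (Fin 3) →ₗᵢ[ℝ] EuclideanSpace ℝ (Fin 3)} {P : Finset (EuclideanSpace ℝ (Fin 3))}
    (hA : ∀ v ∈ P, ‖A v - Q v‖ ≤ θ) {v w : EuclideanSpace ℝ (Fin 3)} (hv : v ∈ P) (hw : w ∈ P) :
    ‖v - w‖ - 2 * θ ≤ ‖A v - A w‖ := by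
  have h1 : ‖Q v - Q w‖ = ‖v - w‖ := by rw [← map_sub, Q.norm_map]
  have h2 : ‖Q v - Q w‖ - ‖A v - A w‖ ≤ ‖(Q v - Q w) - (A v - A w)‖ := norm_sub_norm_le _ _
  have h3 : (Q v - Q w) - (A v - A w) = (A w - Q w) - (A v - Q v) := by abel
  rw [h3] at h2
  have h4 := norm_sub_le (A w - Q w) (A v - Q v)
  linarith [hA v hv, hA w hw]

/-! ## §2  The dictionary -/

/-- **DICTIONARY STEP.**  Frames `(A, P, f)` at `j` (scale `nn_j`) and `(A', P', f')` at `k = f v_k` (scale `nn_k`, exhaustive within `(3/2 + g)·nn_k`): a pattern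
point `v ∈ P` whose site `f v ≠ y k` is within reach of `k` is `f' w` for some `w ∈ P'`, and the frame vectors correspond:
`‖nn_k·A' w − nn_j·(A v − A v_k)‖ ≤ 2ε·nn_j + ε·nn_k`. [this file] -/
theorem dict_step {ε g : ℝ} {y : Fin N → EuclideanSpace ℝ (Fin 3)} {j k : Fin N}
    {A A' : EuclideanSpace ℝ (Fin 3) →ₗ[ℝ] EuclideanSpace ℝ (Fin 3)} {P P' : Finset (EuclideanSpace ℝ (Fin 3))}
    {f f' : EuclideanSpace ℝ (Fin 3) → EuclideanSpace ℝ (Fin 3)}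
    (hfj : ∀ v ∈ P, f v ∈ Set.range y ∧ dist (f v) (y j + nearestDist y j • A v) ≤ ε * nearestDist y j)
    (hfk : ∀ w ∈ P', f' w ∈ Set.range y ∧ dist (f' w) (y k + nearestDist y k • A' w) ≤ ε * nearestDist y k)
    (hexk : ∀ m, m ≠ k → dist (y m) (y k) ≤ (3 / 2 + g) * nearestDist y k → ∃ w ∈ P', f' w = y m)
    {vk : EuclideanSpace ℝ (Fin 3)} (hvk : vk ∈ P) (hfvk : f vk = y k)
    {v : EuclideanSpace ℝ (Fin 3)} (hv : v ∈ P) (hne : f v ≠ y k) (hd : dist (f v) (y k) ≤ (3 / 2 + g) * nearestDist y k) :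
    ∃ w ∈ P', f' w = f v ∧ ‖nearestDist y k • A' w - nearestDist y j • (A v - A vk)‖ ≤ 2 * ε * nearestDist y j + ε * nearestDist y k := by
  obtain ⟨⟨m, hm⟩, hdv⟩ := hfj v hv
  have hmk : m ≠ k := fun h => hne (by rw [← hm, h])
  obtain ⟨w, hw, hfw⟩ := hexk m hmk (by rw [hm]; exact hd)
  have hdw := (hfk w hw).2
  rw [hfw] at hdw
  have hdk := (hfj vk hvk).2
  rw [hfvk] at hdk
  rw [← hm] at hdv
  refine ⟨w, hw, by rw [hfw, hm], ?_⟩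
  have e : nearestDist y k • A' w - nearestDist y j • (A v - A vk)
      = ((y k + nearestDist y k • A' w) - y m) + (y m - (y j + nearestDist y j • A v)) - (y k - (y j + nearestDist y j • A vk)) := by
    rw [smul_sub]; abel
  rw [e]
  have ha : ‖(y k + nearestDist y k • A' w) - y m‖ ≤ ε * nearestDist y k := by rw [← dist_eq_norm, dist_comm]; exact hdw
  have hb : ‖y m - (y j + nearestDist y j • A v)‖ ≤ ε * nearestDist y j := by rw [← dist_eq_norm]; exact hdv
  have hc : ‖y k - (y j + nearestDist y j • A vk)‖ ≤ ε * nearestDist y j := by rw [← dist_eq_norm]; exact hdk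
  have h1 := norm_sub_le (((y k + nearestDist y k • A' w) - y m) + (y m - (y j + nearestDist y j • A v))) (y k - (y j + nearestDist y j • A vk))
  have h2 := norm_add_le ((y k + nearestDist y k • A' w) - y m) (y m - (y j + nearestDist y j • A v))
  linarith

/-- **DICTIONARY BASE.**  The site `j` itself is a pattern point `w₀` of `k`'s frame with `‖nn_k·A' w₀ + nn_j·A v_k‖ ≤ ε·nn_j + ε·nn_k`
(`A' w₀ ≈ −(nn_j/nn_k)·A v_k`). [this file] -/
theorem dict_base {ε g : ℝ} {y : Fin N → EuclideanSpace ℝ (Fin 3)} {j k : Fin N}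
    {A A' : EuclideanSpace ℝ (Fin 3) →ₗ[ℝ] EuclideanSpace ℝ (Fin 3)} {P P' : Finset (EuclideanSpace ℝ (Fin 3))}
    {f f' : EuclideanSpace ℝ (Fin 3) → EuclideanSpace ℝ (Fin 3)}
    (hfj : ∀ v ∈ P, f v ∈ Set.range y ∧ dist (f v) (y j + nearestDist y j • A v) ≤ ε * nearestDist y j)
    (hfk : ∀ w ∈ P', f' w ∈ Set.range y ∧ dist (f' w) (y k + nearestDist y k • A' w) ≤ ε * nearestDist y k)
    (hexk : ∀ m, m ≠ k → dist (y m) (y k) ≤ (3 / 2 + g) * nearestDist y k → ∃ w ∈ P', f' w = y m)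
    {vk : EuclideanSpace ℝ (Fin 3)} (hvk : vk ∈ P) (hfvk : f vk = y k) (hjk : j ≠ k)
    (hd : dist (y j) (y k) ≤ (3 / 2 + g) * nearestDist y k) :
    ∃ w ∈ P', f' w = y j ∧ ‖nearestDist y k • A' w + nearestDist y j • A vk‖ ≤ ε * nearestDist y j + ε * nearestDist y k := by
  obtain ⟨w, hw, hfw⟩ := hexk j hjk hd
  have hdw := (hfk w hw).2
  rw [hfw] at hdw
  have hdk := (hfj vk hvk).2
  rw [hfvk] at hdk
  refine ⟨w, hw, hfw, ?_⟩
  have e : nearestDist y k • A' w + nearestDist y j • A vk = ((y k + nearestDist y k • A' w) - y j) + ((y j + nearestDist y j • A vk) - y k) := by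
    abel
  rw [e]
  have ha : ‖(y k + nearestDist y k • A' w) - y j‖ ≤ ε * nearestDist y k := by rw [← dist_eq_norm, dist_comm]; exact hdw
  have hb : ‖(y j + nearestDist y j • A vk) - y k‖ ≤ ε * nearestDist y j := by rw [← dist_eq_norm, dist_comm]; exact hdk
  have h2 := norm_add_le ((y k + nearestDist y k • A' w) - y j) ((y j + nearestDist y j • A vk) - y k)
  linarith

/-! ## §3  The dictionary's domain -/

/-- **REACH.**  If `λ₀·nn_j ≤ nn_k` (the SCALE half gives `λ₀ = (1 − 2θ − 2ε)/(1 + θ + ε)` for adjacent framed sites) and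
`‖v − v_k‖ + 2θ + 2ε ≤ λ₀·(3/2 + g)`, then the site `f v` is within the exhaustive radius of `k`: `dist (f v) (y k) ≤ (3/2 + g)·nn_k`. [this file] -/
theorem dict_reach {ε θ g lam : ℝ} (hg : 0 ≤ g) {y : Fin N → EuclideanSpace ℝ (Fin 3)} {j k : Fin N}
    {A : EuclideanSpace ℝ (Fin 3) →ₗ[ℝ] EuclideanSpace ℝ (Fin 3)} {Q : EuclideanSpace ℝ (Fin 3) →ₗᵢ[ℝ] EuclideanSpace ℝ (Fin 3)}
    {P : Finset (EuclideanSpace ℝ (Fin 3))} {f : EuclideanSpace ℝ (Fin 3) → EuclideanSpace ℝ (Fin 3)}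
    (hA : ∀ v ∈ P, ‖A v - Q v‖ ≤ θ)
    (hfj : ∀ v ∈ P, f v ∈ Set.range y ∧ dist (f v) (y j + nearestDist y j • A v) ≤ ε * nearestDist y j)
    {vk : EuclideanSpace ℝ (Fin 3)} (hvk : vk ∈ P) (hfvk : f vk = y k) {v : EuclideanSpace ℝ (Fin 3)} (hv : v ∈ P)
    (hsc : lam * nearestDist y j ≤ nearestDist y k) (hvv : ‖v - vk‖ + 2 * θ + 2 * ε ≤ lam * (3 / 2 + g)) :
    dist (f v) (y k) ≤ (3 / 2 + g) * nearestDist y k := by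
  set s := nearestDist y j with hs
  have hs0 : 0 ≤ s := nearestDist_nonneg y j
  have hdv := (hfj v hv).2
  have hdk := (hfj vk hvk).2
  rw [hfvk] at hdk
  have hc : dist (y j + s • A v) (y j + s • A vk) = s * ‖A v - A vk‖ := by
    rw [dist_add_left, dist_eq_norm, ← smul_sub, norm_smul, Real.norm_of_nonneg hs0]
  have htri := dist_triangle4 (f v) (y j + s • A v) (y j + s • A vk) (y k)
  rw [hc, dist_comm (y j + s • A vk) (y k)] at htri
  have hdiff : s * ‖A v - A vk‖ ≤ s * (‖v - vk‖ + 2 * θ) := mul_le_mul_of_nonneg_left (frame_diff_le hA hv hvk) hs0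
  have h1 : dist (f v) (y k) ≤ s * (‖v - vk‖ + 2 * θ + 2 * ε) := by linarith
  have h2 : s * (‖v - vk‖ + 2 * θ + 2 * ε) ≤ s * (lam * (3 / 2 + g)) := mul_le_mul_of_nonneg_left hvv hs0
  have h3 : s * (lam * (3 / 2 + g)) = (3 / 2 + g) * (lam * s) := by ring
  have h4 : (3 / 2 + g) * (lam * s) ≤ (3 / 2 + g) * nearestDist y k := mul_le_mul_of_nonneg_left hsc (by linarith)
  linarith

/-- **Record instance of the reach** at `(ε, θ, g) = (10⁻⁴, 10⁻³, 1/450)` with the SCALE half's one-step ratio `λ₀ = 9967/10⁴`: every pattern point `v` with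
`‖v − v_k‖ ≤ 149/100` (so all `v` at pattern distance `1` or `√2` from `v_k`) is in the dictionary's domain. [this file] -/
theorem dict_reach_record {y : Fin N → EuclideanSpace ℝ (Fin 3)} {j k : Fin N}
    {A : EuclideanSpace ℝ (Fin 3) →ₗ[ℝ] EuclideanSpace ℝ (Fin 3)} {Q : EuclideanSpace ℝ (Fin 3) →ₗᵢ[ℝ] EuclideanSpace ℝ (Fin 3)}
    {P : Finset (EuclideanSpace ℝ (Fin 3))} {f : EuclideanSpace ℝ (Fin 3) → EuclideanSpace ℝ (Fin 3)}
    (hA : ∀ v ∈ P, ‖A v - Q v‖ ≤ 1 / 1000)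
    (hfj : ∀ v ∈ P, f v ∈ Set.range y ∧ dist (f v) (y j + nearestDist y j • A v) ≤ 1 / 10 ^ 4 * nearestDist y j)
    {vk : EuclideanSpace ℝ (Fin 3)} (hvk : vk ∈ P) (hfvk : f vk = y k) {v : EuclideanSpace ℝ (Fin 3)} (hv : v ∈ P)
    (hsc : 9967 / 10000 * nearestDist y j ≤ nearestDist y k) (hvv : ‖v - vk‖ ≤ 149 / 100) :
    dist (f v) (y k) ≤ (3 / 2 + 1 / 450) * nearestDist y k :=
  dict_reach (ε := 1 / 10 ^ 4) (θ := 1 / 1000) (g := 1 / 450) (lam := 9967 / 10000) (by norm_num) hA hfj hvk hfvk hv hsc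
    (by norm_num at hvv ⊢; linarith)

/-- `√2 ≤ 149/100`: the second pattern distance is within the record reach. [this file] -/
theorem sqrt_two_le_reach : Real.sqrt 2 ≤ 149 / 100 := by
  rw [show (149 / 100 : ℝ) = Real.sqrt ((149 / 100) ^ 2) by rw [Real.sqrt_sq (by norm_num)]]
  exact Real.sqrt_le_sqrt (by norm_num)

/-! ## §4  The dictionary preserves the norm classes `{1, √2}` -/

/-- Frame vectors have norm within `θ` of the pattern norm (below). [this file] -/
private theorem norm_sub_le_norm_frame {θ : ℝ} {A : EuclideanSpace ℝ (Fin 3) →ₗ[ℝ] EuclideanSpace ℝ (Fin 3)}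
    {Q : EuclideanSpace ℝ (Fin 3) →ₗᵢ[ℝ] EuclideanSpace ℝ (Fin 3)} {P : Finset (EuclideanSpace ℝ (Fin 3))}
    (hA : ∀ v ∈ P, ‖A v - Q v‖ ≤ θ) {v : EuclideanSpace ℝ (Fin 3)} (hv : v ∈ P) : ‖v‖ - θ ≤ ‖A v‖ := by
  have h2 : ‖Q v‖ - ‖A v‖ ≤ ‖Q v - A v‖ := norm_sub_norm_le _ _
  rw [norm_sub_rev, Q.norm_map] at h2
  linarith [hA v hv]

/-- Frame vectors have norm within `θ` of the pattern norm (above). [this file] -/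
private theorem norm_frame_le_add {θ : ℝ} {A : EuclideanSpace ℝ (Fin 3) →ₗ[ℝ] EuclideanSpace ℝ (Fin 3)}
    {Q : EuclideanSpace ℝ (Fin 3) →ₗᵢ[ℝ] EuclideanSpace ℝ (Fin 3)} {P : Finset (EuclideanSpace ℝ (Fin 3))}
    (hA : ∀ v ∈ P, ‖A v - Q v‖ ≤ θ) {v : EuclideanSpace ℝ (Fin 3)} (hv : v ∈ P) : ‖A v‖ ≤ ‖v‖ + θ := by
  have h2 : ‖A v‖ - ‖Q v‖ ≤ ‖A v - Q v‖ := norm_sub_norm_le _ _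
  rw [Q.norm_map] at h2
  linarith [hA v hv]

/-- **NORM-CLASS PRESERVATION.**  Under the dictionary inequality `‖s'·A' w − s·(A v − A v_k)‖ ≤ 2ε·s + ε·s'` (`dict_step`), two-sided scale comparison
`λ₀·s ≤ s' ≤ μ₀·s` (the SCALE half) and the two gap conditions (true at the record literals, `dict_normClass_record`), a pattern distance `‖v − v_k‖ = 1`
forces `‖w‖ = 1` and `‖v − v_k‖ = √2` forces `‖w‖ = √2`: the dictionary cannot mix the two shells. [this file] -/
theorem dict_normClass {θ ε lam mu s s' : ℝ} (hs : 0 < s) (hs' : 0 ≤ s') (hsc : lam * s ≤ s') (hsc' : s' ≤ mu * s)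
    (hgap1 : 1 + 2 * θ + 2 * ε < lam * (Real.sqrt 2 - θ - ε)) (hgap2 : mu * (1 + θ + ε) < Real.sqrt 2 - 2 * θ - 2 * ε) (hte : θ + ε ≤ 1)
    {A A' : EuclideanSpace ℝ (Fin 3) →ₗ[ℝ] EuclideanSpace ℝ (Fin 3)} {Q Q' : EuclideanSpace ℝ (Fin 3) →ₗᵢ[ℝ] EuclideanSpace ℝ (Fin 3)}
    {P P' : Finset (EuclideanSpace ℝ (Fin 3))} (hP' : P' = fccTwoShellPattern ∨ P' = hcpTwoShellPattern)
    (hA : ∀ v ∈ P, ‖A v - Q v‖ ≤ θ) (hA' : ∀ w ∈ P', ‖A' w - Q' w‖ ≤ θ)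
    {v vk w : EuclideanSpace ℝ (Fin 3)} (hv : v ∈ P) (hvk : vk ∈ P) (hw : w ∈ P')
    (hdict : ‖s' • A' w - s • (A v - A vk)‖ ≤ 2 * ε * s + ε * s') :
    (‖v - vk‖ = 1 → ‖w‖ = 1) ∧ (‖v - vk‖ = Real.sqrt 2 → ‖w‖ = Real.sqrt 2) := by
  have hcl : ‖w‖ = 1 ∨ ‖w‖ = Real.sqrt 2 := by
    rcases hP' with rfl | rfl
    · exact norm_of_mem_fccTwoShellPattern hw
    · exact norm_of_mem_hcpTwoShellPattern hw
  have hrev := abs_norm_sub_norm_le (s' • A' w) (s • (A v - A vk))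
  rw [norm_smul, norm_smul, Real.norm_of_nonneg hs', Real.norm_of_nonneg hs.le] at hrev
  have hlo := (abs_le.mp (hrev.trans hdict)).1
  have hhi := (abs_le.mp (hrev.trans hdict)).2
  have hw_ge : ‖w‖ - θ ≤ ‖A' w‖ := norm_sub_le_norm_frame hA' hw
  have hw_le : ‖A' w‖ ≤ ‖w‖ + θ := norm_frame_le_add hA' hw
  have hv_ge : ‖v - vk‖ - 2 * θ ≤ ‖A v - A vk‖ := le_frame_diff hA hv hvk
  have hv_le : ‖A v - A vk‖ ≤ ‖v - vk‖ + 2 * θ := frame_diff_le hA hv hvk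
  constructor
  · intro h1
    rcases hcl with hc | hc
    · exact hc
    · exfalso
      rw [h1] at hv_le
      rw [hc] at hw_ge
      -- `s'(√2 − θ) ≤ s'‖A' w‖ ≤ s‖A v − A v_k‖ + 2εs + εs' ≤ s(1 + 2θ) + 2εs + εs'`
      have i1 : s' * (Real.sqrt 2 - θ) ≤ s' * ‖A' w‖ := mul_le_mul_of_nonneg_left hw_ge hs'
      have i2 : s * ‖A v - A vk‖ ≤ s * (1 + 2 * θ) := mul_le_mul_of_nonneg_left hv_le hs.le
      have i3 : s' * (Real.sqrt 2 - θ - ε) ≤ s * (1 + 2 * θ + 2 * ε) := by nlinarith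
      have hpos : 0 ≤ Real.sqrt 2 - θ - ε := by
        have h14 : (1 : ℝ) ≤ Real.sqrt 2 := Real.one_le_sqrt.mpr (by norm_num)
        linarith
      have i4 : lam * s * (Real.sqrt 2 - θ - ε) ≤ s' * (Real.sqrt 2 - θ - ε) := mul_le_mul_of_nonneg_right hsc hpos
      have i5 : s * (lam * (Real.sqrt 2 - θ - ε)) ≤ s * (1 + 2 * θ + 2 * ε) := by nlinarith
      have i6 := lt_of_le_of_lt (le_of_mul_le_mul_left i5 hs) hgap1
      exact lt_irrefl _ i6
  · intro h2
    rcases hcl with hc | hc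
    · exfalso
      rw [h2] at hv_ge
      rw [hc] at hw_le
      -- `s(√2 − 2θ) ≤ s‖A v − A v_k‖ ≤ s'‖A' w‖ + 2εs + εs' ≤ s'(1 + θ) + 2εs + εs'`
      have i1 : s * (Real.sqrt 2 - 2 * θ) ≤ s * ‖A v - A vk‖ := mul_le_mul_of_nonneg_left hv_ge hs.le
      have i2 : s' * ‖A' w‖ ≤ s' * (1 + θ) := mul_le_mul_of_nonneg_left hw_le hs'
      have i3 : s * (Real.sqrt 2 - 2 * θ - 2 * ε) ≤ s' * (1 + θ + ε) := by nlinarith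
      have hpos : 0 ≤ 1 + θ + ε := by nlinarith [hgap1, hte]
      have i4 : s' * (1 + θ + ε) ≤ mu * s * (1 + θ + ε) := mul_le_mul_of_nonneg_right hsc' hpos
      have i5 : s * (Real.sqrt 2 - 2 * θ - 2 * ε) ≤ s * (mu * (1 + θ + ε)) := by nlinarith
      have i6 := lt_of_le_of_lt (le_of_mul_le_mul_left i5 hs) hgap2
      exact lt_irrefl _ i6
    · exact hc

/-- **Record instance** at `(ε, θ) = (10⁻⁴, 10⁻³)` with the SCALE half's ratios `λ₀ = 9967/10⁴`, `μ₀ = 10011/10⁴`: the two gap conditions hold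
(`√2 > 141/100`), so the dictionary preserves the norm classes. [this file] -/
theorem dict_normClass_record {s s' : ℝ} (hs : 0 < s) (hs' : 0 ≤ s') (hsc : 9967 / 10000 * s ≤ s') (hsc' : s' ≤ 10011 / 10000 * s)
    {A A' : EuclideanSpace ℝ (Fin 3) →ₗ[ℝ] EuclideanSpace ℝ (Fin 3)} {Q Q' : EuclideanSpace ℝ (Fin 3) →ₗᵢ[ℝ] EuclideanSpace ℝ (Fin 3)}
    {P P' : Finset (EuclideanSpace ℝ (Fin 3))} (hP' : P' = fccTwoShellPattern ∨ P' = hcpTwoShellPattern)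
    (hA : ∀ v ∈ P, ‖A v - Q v‖ ≤ 1 / 1000) (hA' : ∀ w ∈ P', ‖A' w - Q' w‖ ≤ 1 / 1000)
    {v vk w : EuclideanSpace ℝ (Fin 3)} (hv : v ∈ P) (hvk : vk ∈ P) (hw : w ∈ P')
    (hdict : ‖s' • A' w - s • (A v - A vk)‖ ≤ 2 * (1 / 10 ^ 4) * s + 1 / 10 ^ 4 * s') :
    (‖v - vk‖ = 1 → ‖w‖ = 1) ∧ (‖v - vk‖ = Real.sqrt 2 → ‖w‖ = Real.sqrt 2) := by
  have h14 : (141 / 100 : ℝ) < Real.sqrt 2 := by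
    rw [show (141 / 100 : ℝ) = Real.sqrt ((141 / 100) ^ 2) by rw [Real.sqrt_sq (by norm_num)]]
    exact Real.sqrt_lt_sqrt (by norm_num) (by norm_num)
  exact dict_normClass (θ := 1 / 1000) (ε := 1 / 10 ^ 4) (lam := 9967 / 10000) (mu := 10011 / 10000) hs hs' hsc hsc'
    (by nlinarith [h14]) (by nlinarith [h14]) (by norm_num) hP' hA hA' hv hvk hw hdict

end Summit.AtomisticToContinuum.Crystallization.Theorems.OverbindingBudgetAffineCompressedCutDict
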